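import Mathlib
import Literature.NumberTheory.LFunctions.Zhang2022.TypedSection10Rel
import HarnessLib

/-!
# Zhang (2022), Lemma 10.2 in the reading of record RT-01′: `Skeleton.Lemma102RelW` (clauses
# (10.8)–(10.10) relative, window clause (10.11) in the DERIVABLE tail-mean form) and the §18 consumer
# node `Skeleton.Ded183RelW` — typed statements + bookkeeping bridges, no analytic proofs

Topic `Literature/NumberTheory/LFunctions/Zhang2022` (Landau–Siegel audit tree; verdict-neutral).
Y. Zhang, *Discrete mean estimates and the Landau–Siegel zero*, arXiv:2211.02515v1 (2022)
[Zhang2022LandauSiegel], §10 Lemma 10.2 (pp. 55–56, tex L2789–L2868), §18 pp. 100–101 — **an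
unrefereed manuscript under adjudication: the two `def … : Prop` below are CLAIMS OF THE MANUSCRIPT in
the reading named in their docstrings, STATED NOT ASSERTED.** Discharge lane ZHANG-L, WP10 typer, filed
on the lead's ruling R-13 (RT-01 → RT-01′, HOME/RETYPE-LEDGER) with the WP10 referees' words on the
window clause: WEIGHT `R(d,r) = (∏_{q∣dr}(1 − q⁻¹)⁻¹)²` as in clauses 1–3 (zl-w10-ref-1 22:49Z,
zl-ref-chief 23:08Z) and EXPONENT in the derivable tail-mean form (zl-w10-ref-2 23:10Z memo
`RT01-CLAUSE4-EXPONENT.md`, confirming the leaf claimant zl-w10-p6's reading D3).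

WHY THIS READING (numbers, not adjectives). By the kernel identity `Lemma102.frakv2_eq_logMeans`
(tent decomposition) `𝔳₂ⱼ(d,r) = (500/log P)(A(P^{.504}/dr) − 2A(P^{.502}/dr) + A(P^{.5}/dr))`,
`A(X) = Σ_{n≤X} χ(n)ξ₀ⱼ(n;d,r)n⁻¹log(X/n)`. On the three main ranges every non-empty mean has
`T ≤ X ≤ P` and the shift-0 log-mean estimate (`Typed.Sec10Rel.LogMean0Rel`, «LEMMA A», error
`C𝓛⁻⁶R(d,r)`) gives (10.8)–(10.10) with error `C𝓛⁻¹⁵R(d,r)` (tree: `Lemma102.eq108Rel_of_logMean` …,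
p417365; row G-d43-1). On each of the three EDGE WINDOWS exactly one mean is SHORT (`1 ≤ X < T`), where
no contour evaluation is displayed in print («similar to (10.5)», p. 56 tex L2853; row G-d60-1); the
tree's uniform tail mean `XiZeroTailMean.xiZeroTailMean` (`Σ_{n<x}|ξ₀ⱼ(n;d,r)|/n ≤ C𝓛(1 + log x)³`,
`x ≤ T`) bounds a short mean by `C𝓛(1 + log T)⁴`, and the long means contribute
`|L′(1,χ)Π(d,r)|·O(1) ≪ 𝓛²R(d,r) ≤ 𝓛(1 + log T)⁴R(d,r)`. Hence the derivable window bound is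
`‖𝔳₂ⱼ(d,r)‖ ≤ C·𝓛(1 + log T)⁴/log P·R(d,r)` (`≈ C𝓛^{−3.6}R(d,r)`: `log T = 𝓛^{1.1}`, `log P = 𝓛⁹`) —
clause 4 below. The printed uniform `≪ 𝓛⁻⁷` (`Typed.Sec10A.Eq1011`), the uniform clause 4 of
`Skeleton.Lemma102Rel`, and the exponent-7 weighted reading `Typed.Sec10Rel.Lemma102RelW` /
`Typed.Sec10Rel.Eq1011RelW` (p473917, the text of R-13 / ref-1 22:49Z before the exponent finding) all
IMPLY this one (`lemma102RelW_of_typedRelW`, `lemma102RelW_of_lemma102Rel`, `lemma102RelW_of_lemma102`;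
for `𝓛 ≥ 1`, `𝓛⁻⁷ ≤ 𝓛(1 + log T)⁴/log P`, `inv_ell_pow_seven_le`), so the re-typed leaf is AT MOST AS
STRONG as print. Consumer arithmetic (referee memo §3): the §18 window term is
`mass × C𝓛⁻⁷ × clause 4`; with the window mass sharpened to `c·log T = c𝓛^{1.1}` the total is
`𝓛^{−9.5} = o(α)` (`α = π𝓛⁻⁹`), so the port `ded183RelW_holds : Ded183RelW c′` of
`Typed.Section18.ded183_holds` closes against THIS leaf (mass exponent 5 → 7 for `R(d,r)`, window mass
`𝓛² → 𝓛^{1.1}`); the §10 consumers follow the precedent `Section10CRanges1422` (window log-length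
`𝓛^{1.1}`, `m`-sum `𝓛⁻⁷`).

Contents: `Skeleton.Lemma102RelW c′`, `Skeleton.Ded183RelW c′` (CLAIMS); `Typed.Sec10Rel.Eq1011RelD c′`
(the window clause alone, same reading); bridges `lemma102RelW_iff_eqs`
(`↔ Eq108Rel ∧ Eq109Rel ∧ Eq1010Rel ∧ Eq1011RelD`), `lemma102RelW_of_logMean0Rel`
(`LogMean0Rel → Eq1011RelD → Lemma102RelW`: the leaf ⇐ LEMMA A + the window bound),
`eq1011RelD_of_eq1011RelW`, `lemma102RelW_of_typedRelW`, `lemma102RelW_of_lemma102Rel`,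
`lemma102RelW_of_lemma102`, `ded183Rel_of_ded183RelW`, `ded183_of_ded183RelW`,
`typedDed183RelW_of_ded183RelW`, and the comparison `inv_ell_pow_seven_le`. Bookkeeping only; 0 new
objects, 0 facts. WHAT THIS IS NOT: a proof of Lemma 10.2 in any reading, the skeleton re-thread itself
(zl-skel, after the §18 port lands), or anything about Theorems 1–2 of the source / Landau–Siegel zeros.

## References

* Y. Zhang, arXiv:2211.02515v1 (2022), §10 Lemma 10.2 pp. 55–56 (tex L2789–L2868), §18 pp. 100–101.
  [cite: Zhang2022LandauSiegel, §10 Lemma 10.2]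
-/

noncomputable section

open Complex Real

/-! ## The window clause alone (display (10.11) in the tail-mean reading) -/

namespace Literature.NumberTheory.LFunctions.Zhang2022.Typed.Sec10Rel

open Literature.NumberTheory.LFunctions.Zhang2022
open Literature.NumberTheory.LFunctions.Zhang2022.Skeleton

/-- **(10.11), tail-mean reading (D3)** (p. 55 tex L2817; p. 56 tex L2853 «similar to (10.5)»; row
G-d60-1): on the three edge windows `Typed.Sec10A.edgeWindows` (at `y = dr`),
`‖𝔳₂ⱼ(d,r)‖ ≤ C·𝓛(1 + log T)⁴/log P·(∏_{q∣dr}(1 − q⁻¹)⁻¹)²` — what the tent decomposition, the shift-0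
log-mean estimate on the long means and the tree's tail mean `XiZeroTailMean.xiZeroTailMean` on the one
short mean deliver (see the module docstring). Implied by the exponent-7 reading `Eq1011RelW`
(`eq1011RelD_of_eq1011RelW`). CLAIM (reading), stated not asserted.
[cite: Zhang2022LandauSiegel, §10 (10.11) p.55] -/
def Eq1011RelD (c' : ℝ) : Prop :=
  ∃ C : ℝ, ForAllLarge fun D _ χ => AssumptionA D χ →
    ∀ j ∈ ({1, 2, 3} : Finset ℕ), ∀ d r : ℕ, 1 ≤ d → 1 ≤ r →
      ((d * r : ℕ) : ℝ) ∈ Sec10A.edgeWindows D →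
        ‖frakv2 c' χ j d r‖ ≤
          C * ell D * (1 + Real.log (bigT D)) ^ 4 / Real.log (bigP D) *
            (∏ q ∈ (d * r).primeFactors, (1 - (q : ℝ)⁻¹)⁻¹) ^ 2

end Literature.NumberTheory.LFunctions.Zhang2022.Typed.Sec10Rel

namespace Literature.NumberTheory.LFunctions.Zhang2022.Skeleton

open Literature.NumberTheory.LFunctions.Zhang2022
open Literature.NumberTheory.LFunctions.Zhang2022.Typed.Sec10Rel (LogMean0Rel Eq108Rel Eq109Rel
  Eq1010Rel Eq1011RelW Eq1011RelD)

/-! ## Statements (readings of record RT-01′) -/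

section Statements

variable (c' : ℝ)

/-- **Lemma 10.2, reading of record RT-01′** (§10 pp. 55–56): the four ranges (10.8)–(10.11) for
`𝔳₂ⱼ(d,r) = Σ_n χ(n)f̃(log(drn)/log P)ξ₀ⱼ(n;d,r)n⁻¹` with ONE uniform constant `C` —
clauses 1–3 = `Skeleton.Lemma102Rel` VERBATIM ((10.8)–(10.10) with error
`C𝓛⁻¹⁵(∏_{q∣dr}(1 − q⁻¹)⁻¹)²`, row G-d43-1), clause 4 = the window bound (10.11) in the DERIVABLE
tail-mean form `‖𝔳₂ⱼ(d,r)‖ ≤ C·𝓛(1 + log T)⁴/log P·(∏_{q∣dr}(1 − q⁻¹)⁻¹)²` on the three windows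
`(P^{0.5}/T, P^{0.5}] ∪ (P^{0.502}/T, P^{0.502}] ∪ (P^{0.504}/T, P^{0.504})` (row G-d60-1; WP10
referees: weight zl-w10-ref-1 22:49Z / zl-ref-chief 23:08Z, exponent zl-w10-ref-2 23:10Z; the printed
clause reads `≪ 𝓛⁻⁷` uniformly). Implied by the printed `Skeleton.Lemma102`, by `Skeleton.Lemma102Rel`
and by `Typed.Sec10Rel.Lemma102RelW` (bridges below). CLAIM (reading), stated not asserted.
[cite: Zhang2022LandauSiegel, §10 Lemma 10.2 p.55] -/
def Lemma102RelW : Prop :=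
  ∃ C : ℝ, ForAllLarge fun D _ χ => AssumptionA D χ →
    ∀ j ∈ ({1, 2, 3} : Finset ℕ), ∀ d r : ℕ, 1 ≤ d → 1 ≤ r →
      (((d * r : ℕ) : ℝ) ≤ bigP D ^ (0.5 : ℝ) / bigT D →
        ‖frakv2 c' χ j d r - deriv χ.LFunction 1 * PiW χ d r / 500 *
          (betaJ c' D (j + 1) * betaJ c' D (j + 2)) * Real.log (bigP D)‖ ≤
            C * (ell D ^ 15)⁻¹ * (∏ q ∈ (d * r).primeFactors, (1 - (q : ℝ)⁻¹)⁻¹) ^ 2) ∧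
      (bigP D ^ (0.5 : ℝ) < ((d * r : ℕ) : ℝ) → ((d * r : ℕ) : ℝ) ≤ bigP D ^ (0.502 : ℝ) / bigT D →
        ‖frakv2 c' χ j d r - 500 * deriv χ.LFunction 1 * PiW χ d r / Real.log (bigP D) *
          (-1 + fraky1 c' D j ((d * r : ℕ) : ℝ))‖ ≤
            C * (ell D ^ 15)⁻¹ * (∏ q ∈ (d * r).primeFactors, (1 - (q : ℝ)⁻¹)⁻¹) ^ 2) ∧
      (bigP D ^ (0.502 : ℝ) < ((d * r : ℕ) : ℝ) →
        ((d * r : ℕ) : ℝ) ≤ bigP D ^ (0.504 : ℝ) / bigT D →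
        ‖frakv2 c' χ j d r - 500 * deriv χ.LFunction 1 * PiW χ d r / Real.log (bigP D) *
          (1 + fraky2 c' D j ((d * r : ℕ) : ℝ))‖ ≤
            C * (ell D ^ 15)⁻¹ * (∏ q ∈ (d * r).primeFactors, (1 - (q : ℝ)⁻¹)⁻¹) ^ 2) ∧
      ((bigP D ^ (0.5 : ℝ) / bigT D < ((d * r : ℕ) : ℝ) ∧ ((d * r : ℕ) : ℝ) ≤ bigP D ^ (0.5 : ℝ)) ∨
          (bigP D ^ (0.502 : ℝ) / bigT D < ((d * r : ℕ) : ℝ) ∧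
            ((d * r : ℕ) : ℝ) ≤ bigP D ^ (0.502 : ℝ)) ∨
          (bigP D ^ (0.504 : ℝ) / bigT D < ((d * r : ℕ) : ℝ) ∧
            ((d * r : ℕ) : ℝ) < bigP D ^ (0.504 : ℝ)) →
        ‖frakv2 c' χ j d r‖ ≤
          C * ell D * (1 + Real.log (bigT D)) ^ 4 / Real.log (bigP D) *
            (∏ q ∈ (d * r).primeFactors, (1 - (q : ℝ)⁻¹)⁻¹) ^ 2)

/-- **§18 pp. 100–101, the bound for (18.3), from Lemma 10.1 and Lemma 10.2 in the reading
`Lemma102RelW`** — the banked consumer node `Skeleton.Ded183` (`Eq183 → Prop71 → Lemma101 → Lemma102 →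
Bound183`; kernel theorem `Typed.Section18.ded183_holds`) re-pointed to `Lemma102RelW` (precondition
of RT-01′: a port `ded183RelW_holds : Ded183RelW c′` with mass exponent 5 → 7 and window mass
`c·𝓛^{1.1}`). CLAIM (deduction node), stated not asserted. [cite: Zhang2022LandauSiegel, §18 pp.100–101, (18.3)] -/
def Ded183RelW : Prop := Eq183 c' → Prop71 c' → Lemma101 c' → Lemma102RelW c' → Bound183 c'

end Statements

/-! ## Bookkeeping bridges (no analytic content) -/

section Edges

variable {c' : ℝ}

/-- `(𝓛ᵏ)⁻¹ ≥ 0`. [folklore] -/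
private theorem ell_pow_inv_nonneg' (D k : ℕ) : 0 ≤ (ell D ^ k)⁻¹ :=
  inv_nonneg.mpr (pow_nonneg (Real.log_natCast_nonneg D) k)

/-- `R(d,r) = (∏_{q∣dr}(1 − q⁻¹)⁻¹)² ≥ 1`. [folklore] -/
private theorem one_le_relFactor' (n : ℕ) :
    1 ≤ (∏ q ∈ n.primeFactors, (1 - (q : ℝ)⁻¹)⁻¹) ^ 2 := by
  have hprod : 1 ≤ ∏ q ∈ n.primeFactors, (1 - (q : ℝ)⁻¹)⁻¹ := by
    refine le_of_eq_of_le (Finset.prod_const_one (s := n.primeFactors)).symm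
      (Finset.prod_le_prod (fun _ _ => zero_le_one) fun q hq => ?_)
    have hq2 : (2 : ℝ) ≤ q := by exact_mod_cast (Nat.prime_of_mem_primeFactors hq).two_le
    have h1 : 0 < 1 - (q : ℝ)⁻¹ := by
      have : (q : ℝ)⁻¹ ≤ 1 / 2 := by rw [inv_eq_one_div]; gcongr
      linarith
    have h2 : 1 - (q : ℝ)⁻¹ ≤ 1 := by
      have : 0 ≤ (q : ℝ)⁻¹ := by positivity
      linarith
    exact (one_le_inv₀ h1).mpr h2
  nlinarith

/-- `R(d,r) ≥ 0`. [folklore] -/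
private theorem relFactor_nonneg' (n : ℕ) :
    0 ≤ (∏ q ∈ n.primeFactors, (1 - (q : ℝ)⁻¹)⁻¹) ^ 2 :=
  zero_le_one.trans (one_le_relFactor' n)

/-- `1 ≤ 𝓛 = log D` once `D ≥ 3`. [folklore] -/
private theorem one_le_ell_of_three_le {D : ℕ} (hD : 3 ≤ D) : 1 ≤ ell D := by
  rw [ell]
  have h3 : (3 : ℝ) ≤ (D : ℝ) := by exact_mod_cast hD
  have he : Real.exp 1 ≤ (D : ℝ) :=
    le_trans (by have := Real.exp_one_lt_d9; norm_num at this ⊢; linarith) h3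
  exact (Real.le_log_iff_exp_le (by linarith)).mpr he

/-- The window scale of RT-01′ dominates the printed one: for `𝓛 ≥ 1`,
`(𝓛⁷)⁻¹ ≤ 𝓛(1 + log T)⁴/log P` (`log T = 𝓛^{1.1} ≥ 𝓛`, `log P = 𝓛⁹`; (2.6) and the definition of `T`,
§2 p. 8). [cite: Zhang2022LandauSiegel, §2 (2.6) p.5; §10 (10.11) p.55] -/
theorem inv_ell_pow_seven_le {D : ℕ} (hL : 1 ≤ ell D) :
    (ell D ^ 7)⁻¹ ≤ ell D * (1 + Real.log (bigT D)) ^ 4 / Real.log (bigP D) := by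
  have hlogT : Real.log (bigT D) = ell D ^ (1.1 : ℝ) := by rw [bigT, Real.log_exp]
  have hlogP : Real.log (bigP D) = ell D ^ 9 := by rw [bigP, Real.log_exp]
  have hL0 : 0 < ell D := by linarith
  have hT : ell D ≤ 1 + Real.log (bigT D) := by
    rw [hlogT]
    have : ell D ≤ ell D ^ (1.1 : ℝ) := by
      calc ell D = ell D ^ (1 : ℝ) := (Real.rpow_one _).symm
        _ ≤ ell D ^ (1.1 : ℝ) := Real.rpow_le_rpow_of_exponent_le hL (by norm_num)
    linarith
  rw [hlogP, div_eq_mul_inv]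
  have h4 : ell D ^ 4 ≤ (1 + Real.log (bigT D)) ^ 4 := pow_le_pow_left₀ hL0.le hT 4
  rw [inv_le_iff_one_le_mul₀ (pow_pos hL0 7)]
  calc (1 : ℝ) ≤ ell D ^ 3 := one_le_pow₀ hL
    _ = ell D * ell D ^ 4 * (ell D ^ 9)⁻¹ * ell D ^ 7 := by field_simp
    _ ≤ ell D * (1 + Real.log (bigT D)) ^ 4 * (ell D ^ 9)⁻¹ * ell D ^ 7 := by gcongr

/-- The window scale is `≥ 0`. [folklore] -/
private theorem windowScale_nonneg (D : ℕ) :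
    0 ≤ ell D * (1 + Real.log (bigT D)) ^ 4 / Real.log (bigP D) := by
  have hℓ : 0 ≤ ell D := Real.log_natCast_nonneg D
  have hlogP : Real.log (bigP D) = ell D ^ 9 := by rw [bigP, Real.log_exp]
  have hlogT : 0 ≤ 1 + Real.log (bigT D) := by
    rw [bigT, Real.log_exp]; positivity
  rw [hlogP]
  positivity

/-- Enlarging the constant in a bound `t ≤ C·a·R` (`a, R ≥ 0`). [folklore] -/
private theorem lift_const' {C C' a R t : ℝ} (ht : t ≤ C * a * R) (hC : C ≤ C') (ha : 0 ≤ a)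
    (hR : 0 ≤ R) : t ≤ C' * a * R :=
  ht.trans (mul_le_mul_of_nonneg_right (mul_le_mul_of_nonneg_right hC ha) hR)

/-- **The exponent-7 window reading implies the tail-mean reading** (after bumping `D₀` so that
`𝓛 ≥ 1`). [cite: Zhang2022LandauSiegel, §10 (10.11) p.55] -/
theorem eq1011RelD_of_eq1011RelW (h : Eq1011RelW c') : Eq1011RelD c' := by
  obtain ⟨C, D₀, hC⟩ := h
  refine ⟨|C|, max D₀ 3, fun D _ χ hD hq hp hA j hj d r hd hr hy => ?_⟩
  have hD₀ : D₀ ≤ D := le_trans (le_max_left _ _) hD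
  have hL : 1 ≤ ell D := one_le_ell_of_three_le (le_trans (le_max_right _ _) hD)
  have h1 := hC D χ hD₀ hq hp hA j hj d r hd hr hy
  have hR := relFactor_nonneg' (d * r)
  have h7 := ell_pow_inv_nonneg' D 7
  calc ‖frakv2 c' χ j d r‖
      ≤ C * (ell D ^ 7)⁻¹ * (∏ q ∈ (d * r).primeFactors, (1 - (q : ℝ)⁻¹)⁻¹) ^ 2 := h1
    _ ≤ |C| * (ell D ^ 7)⁻¹ * (∏ q ∈ (d * r).primeFactors, (1 - (q : ℝ)⁻¹)⁻¹) ^ 2 :=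
        lift_const' le_rfl (le_abs_self C) h7 hR
    _ ≤ |C| * (ell D * (1 + Real.log (bigT D)) ^ 4 / Real.log (bigP D)) *
          (∏ q ∈ (d * r).primeFactors, (1 - (q : ℝ)⁻¹)⁻¹) ^ 2 :=
        mul_le_mul_of_nonneg_right (mul_le_mul_of_nonneg_left (inv_ell_pow_seven_le hL)
          (abs_nonneg C)) hR
    _ = |C| * ell D * (1 + Real.log (bigT D)) ^ 4 / Real.log (bigP D) *
          (∏ q ∈ (d * r).primeFactors, (1 - (q : ℝ)⁻¹)⁻¹) ^ 2 := by ring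

/-- **`Lemma102RelW` ⇔ its four displays** `Eq108Rel ∧ Eq109Rel ∧ Eq1010Rel ∧ Eq1011RelD` (merge /
split the uniform constant; cf. `Typed.Sec10A.lemma102_iff_eqs`). [cite: Zhang2022LandauSiegel, §10 Lemma 10.2 p.55] -/
theorem lemma102RelW_iff_eqs :
    Lemma102RelW c' ↔ Eq108Rel c' ∧ Eq109Rel c' ∧ Eq1010Rel c' ∧ Eq1011RelD c' := by
  constructor
  · rintro ⟨C, hF⟩
    refine ⟨⟨C, hF.mono fun D _ χ _ _ h hA j hj d r hd hr => (h hA j hj d r hd hr).1⟩,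
      ⟨C, hF.mono fun D _ χ _ _ h hA j hj d r hd hr => (h hA j hj d r hd hr).2.1⟩,
      ⟨C, hF.mono fun D _ χ _ _ h hA j hj d r hd hr => (h hA j hj d r hd hr).2.2.1⟩,
      ⟨C, hF.mono fun D _ χ _ _ h hA j hj d r hd hr hy => (h hA j hj d r hd hr).2.2.2 ?_⟩⟩
    exact (Typed.Sec10A.mem_edgeWindows_iff D _).mp hy
  · rintro ⟨⟨C₂, h₂⟩, ⟨C₃, h₃⟩, ⟨C₄, h₄⟩, ⟨C₅, h₅⟩⟩
    refine ⟨max (max C₂ C₃) (max C₄ C₅), ((h₂.and h₃).and (h₄.and h₅)).mono ?_⟩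
    intro D _ χ _ _ h hA j hj d r hd hr
    obtain ⟨⟨k₂, k₃⟩, k₄, k₅⟩ := h
    have h15 := ell_pow_inv_nonneg' D 15
    have hW := windowScale_nonneg D
    have hR := relFactor_nonneg' (d * r)
    refine ⟨fun hy => lift_const' (k₂ hA j hj d r hd hr hy)
        ((le_max_left _ _).trans (le_max_left _ _)) h15 hR,
      fun hy1 hy2 => lift_const' (k₃ hA j hj d r hd hr hy1 hy2)
        ((le_max_right _ _).trans (le_max_left _ _)) h15 hR,
      fun hy1 hy2 => lift_const' (k₄ hA j hj d r hd hr hy1 hy2)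
        ((le_max_left _ _).trans (le_max_right _ _)) h15 hR,
      fun hy => ?_⟩
    have := k₅ hA j hj d r hd hr ((Typed.Sec10A.mem_edgeWindows_iff D _).mpr hy)
    rw [mul_div_assoc, mul_assoc C₅] at this
    rw [mul_div_assoc, mul_assoc (max (max C₂ C₃) (max C₄ C₅))]
    exact lift_const' (a := ell D * ((1 + Real.log (bigT D)) ^ 4 / Real.log (bigP D))) this
      ((le_max_right _ _).trans (le_max_right _ _)) (by rw [← mul_div_assoc]; exact hW) hR

/-- **ASSEMBLY of the leaf of record from its two analytic inputs**: the shift-0 log-mean estimate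
(`Typed.Sec10Rel.LogMean0Rel`, «LEMMA A») and the window bound `Eq1011RelD` give `Lemma102RelW`
((10.8)–(10.10) by the tree's `Section10Lemma102Steps`). [cite: Zhang2022LandauSiegel, §10 Lemma 10.2 pp.55–56] -/
theorem lemma102RelW_of_logMean0Rel (hA : LogMean0Rel c') (h11 : Eq1011RelD c') :
    Lemma102RelW c' :=
  lemma102RelW_iff_eqs.mpr ⟨Typed.Sec10Rel.eq108Rel_of_logMean0Rel hA,
    Typed.Sec10Rel.eq109Rel_of_logMean0Rel hA, Typed.Sec10Rel.eq1010Rel_of_logMean0Rel hA, h11⟩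

/-- The exponent-7 weighted reading `Typed.Sec10Rel.Lemma102RelW` (text of R-13 / ref-1 22:49Z)
implies the reading of record. [cite: Zhang2022LandauSiegel, §10 Lemma 10.2 p.55] -/
theorem lemma102RelW_of_typedRelW (h : Typed.Sec10Rel.Lemma102RelW c') : Lemma102RelW c' := by
  obtain ⟨h8, h9, h10, h11⟩ := Typed.Sec10Rel.lemma102RelW_iff_eqs.mp h
  exact lemma102RelW_iff_eqs.mpr ⟨h8, h9, h10, eq1011RelD_of_eq1011RelW h11⟩

/-- `Skeleton.Lemma102Rel` (clause 4 uniform) implies the reading of record.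
[cite: Zhang2022LandauSiegel, §10 Lemma 10.2 p.55] -/
theorem lemma102RelW_of_lemma102Rel (h : Lemma102Rel c') : Lemma102RelW c' :=
  lemma102RelW_of_typedRelW (Typed.Sec10Rel.lemma102RelW_of_lemma102Rel h)

/-- The printed Lemma 10.2 implies the reading of record (honesty: the re-typed leaf is at most as
strong as print). [cite: Zhang2022LandauSiegel, §10 Lemma 10.2 p.55] -/
theorem lemma102RelW_of_lemma102 (h : Lemma102 c') : Lemma102RelW c' :=
  lemma102RelW_of_lemma102Rel (lemma102Rel_of_lemma102 h)

/-- A closer of `Ded183RelW` serves the banked `Skeleton.Ded183Rel` … [cite: Zhang2022LandauSiegel, §18 pp.100–101] -/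
theorem ded183Rel_of_ded183RelW (h : Ded183RelW c') : Ded183Rel c' :=
  fun h183 h71 h101 h102 => h h183 h71 h101 (lemma102RelW_of_lemma102Rel h102)

/-- … the banked `Skeleton.Ded183` (v19 chain) … [cite: Zhang2022LandauSiegel, §18 pp.100–101] -/
theorem ded183_of_ded183RelW (h : Ded183RelW c') : Ded183 c' :=
  fun h183 h71 h101 h102 => h h183 h71 h101 (lemma102RelW_of_lemma102 h102)

/-- … and the exponent-7 node `Typed.Sec10Rel.Ded183RelW`. [cite: Zhang2022LandauSiegel, §18 pp.100–101] -/
theorem typedDed183RelW_of_ded183RelW (h : Ded183RelW c') : Typed.Sec10Rel.Ded183RelW c' :=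
  fun h183 h71 h101 h102 => h h183 h71 h101 (lemma102RelW_of_typedRelW h102)

end Edges

end Literature.NumberTheory.LFunctions.Zhang2022.Skeleton
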